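import Summits.CriticalPhenomena.PercolationContinuityZ3.Theorems.PercNearOneGluingNoHeavyLowerTailSahiTwoLevelVariational
import Mathlib.Tactic.Linarith
import Mathlib.Tactic.Ring
import HarnessLib

/-!
# The VARIATIONAL ROUTE's typed target `SolvedFaceDescent` is EQUIVALENT to the two-level TOP law `SahiTwoLevelPlus`

Support file of the one-cut programme (crux `NoHeavyLowerTail`, stmt-CriticalPhenomena-4575), lead seat `prim-nh-lead-4575` gen 111,
on `…SahiTwoLevelVariational` (master-family line P2, seat `prim-masterthm-p2` gen 20).  No new definition, no sorry, axioms standard.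

THE OBSERVATION.  In the compact form
`T⁺ = 2μ(H₀H₁H₂) − Σ_i μ(G_i)μ(H_jH_k) − Σ_i μ(H_i)·Cov(G_j,G_k) + 2μ(G₀G₁G₂) − μ(G₀)μ(G₁)μ(G₂)` (`topForm_eq_compact`)
EVERY monomial contains exactly one slot-`0` event (`H₀` or `G₀`).  Hence replacing slot `0` by the EMPTY nested pair `(H₀,G₀) = (∅,∅)`
(both increasing, determined by every coordinate set) gives `T⁺ = 0` (`topForm_slot₀_empty`), and the empty sextuple lies in the W-face
(`inSolvedFace_of_bottom₀_empty`).  Two consequences: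

* `topForm_le_zero_of_slot₀_minimal` — a nested pair that is STABLE under the same-slot-pair replacement in slot `0` (no nested pair of
  increasing events in slot `0` has smaller `T⁺`) has `T⁺ ≤ 0`.  So on every cube and weight where the top law holds, the STABLE sextuples of
  the memo's LEMMA S′ are EXACTLY the zeros of `T⁺` (lead census `{0,1}^3`: 90 224 stable = 90 224 zeros, the same set at 11 bias vectors).
* **`solvedFaceDescentOn_iff`** / **`solvedFaceDescent_iff_sahiTwoLevelPlus`** — `SolvedFaceDescentOn q` is EQUIVALENT to `T⁺ ≥ 0` for every
  nested pair of increasing triples on that cube and weight (witness of the descent: the empty sextuple; converse through P2's reduction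
  `sahiE3_nonneg_of_solvedFaceDescentOn` + `topForm_nonneg_of_inSolvedFace`), and `SolvedFaceDescent ↔ SahiTwoLevelPlus`.
  The typed target of the variational route is therefore a RESTATEMENT of the two-level top law (`kahnConjecture_of_solvedFaceDescent` is
  `kahnConjecture_of_sahiTwoLevelPlus`); what the route adds is a METHOD (first-order conditions at a minimiser), not a weaker obligation.

HONEST LABEL: elementary; nothing here asserts `SahiTwoLevelPlus`, `SolvedFaceDescent` or Kahn's Conjecture 5 (all OPEN). [this work]
-/

noncomputable section

open scoped Classical

namespace Summit.CriticalPhenomena.PercolationContinuityZ3.Theorems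

namespace SahiTwoLevelVariational

open MeasureTheory
open Literature.Probability.LatticeModels (prodBernoulli)
open Literature.Probability.Percolation (DeterminedBy determinedBy_iff)

variable {κ : Type} [Fintype κ]

/-! ### 1. The empty slot -/

omit [Fintype κ] in
/-- **Emptying slot `0` kills `T⁺`**: `T⁺((∅,G₁,G₂),(∅,H₁,H₂)) = 0` — every monomial of the compact form contains `H₀` or `G₀`. [this work] -/
theorem topForm_slot₀_empty (q : κ → unitInterval) (G H : Fin 3 → Set (Set κ)) :
    topForm q ![(∅ : Set (Set κ)), G 1, G 2] ![(∅ : Set (Set κ)), H 1, H 2] = 0 := by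
  rw [topForm_eq_compact]
  simp

omit [Fintype κ] in
/-- The empty sextuple has `T⁺ = 0`. [this work] -/
theorem topForm_empty (q : κ → unitInterval) :
    topForm q (fun _ => (∅ : Set (Set κ))) (fun _ => (∅ : Set (Set κ))) = 0 := by
  rw [topForm_eq_compact]
  simp

omit [Fintype κ] in
/-- An empty bottom in slot `0` puts the pair in the W-face, hence in a solved face. [this work] -/
theorem inSolvedFace_of_bottom₀_empty (q : κ → unitInterval) (G H : Fin 3 → Set (Set κ)) (h0 : H 0 = ∅) :
    InSolvedFace q G H := by
  refine Or.inl (Or.inl ?_)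
  rw [h0]
  intro ω hω
  simp at hω

omit [Fintype κ] in
/-- The empty event is determined by every coordinate set. [this work] -/
theorem determinedBy_empty (S : Set κ) : DeterminedBy (∅ : Set (Set κ)) S :=
  (determinedBy_iff _ _).2 fun _ _ _ => by simp

/-- Every event is determined by the full coordinate set. [this work] -/
theorem determinedBy_univ (X : Set (Set κ)) : DeterminedBy X ((Finset.univ : Finset κ) : Set κ) :=
  (determinedBy_iff _ _).2 fun ω ω' hω => by
    rw [Finset.coe_univ, Set.inter_univ, Set.inter_univ] at hω; rw [hω]

/-! ### 2. Stability under the slot-`0` pair move forces `T⁺ ≤ 0` -/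

omit [Fintype κ] in
/-- **A slot-`0`-minimal nested pair has `T⁺ ≤ 0`.**  If no replacement of `(H₀,G₀)` by a nested pair of increasing events lowers `T⁺`
(in particular at every sextuple that is stable under same-slot-pair moves, and at every global minimiser), then `T⁺ ≤ 0` — compare with
`(∅,∅)`.  Consequently, wherever the top law holds, "stable" means exactly "`T⁺ = 0`". [this work] -/
theorem topForm_le_zero_of_slot₀_minimal (q : κ → unitInterval) (G H : Fin 3 → Set (Set κ))
    (hmin : ∀ X Y : Set (Set κ), IsUpperSet X → IsUpperSet Y → X ⊆ Y →
      topForm q G H ≤ topForm q ![Y, G 1, G 2] ![X, H 1, H 2]) :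
    topForm q G H ≤ 0 := by
  have h := hmin ∅ ∅ isUpperSet_empty isUpperSet_empty (Set.empty_subset _)
  rwa [topForm_slot₀_empty] at h

/-! ### 3. The equivalences -/

/-- **On a fixed cube and weight, solved-face descent ⟺ the top two-level law for all nested pairs of increasing triples.**
(⇐): the empty sextuple is the descent target.  (⇒): P2's reduction gives `E_3 ≥ 0` for all increasing triples on this cube, hence
`MixedE3Nonneg`, hence `T⁺ ≥ 0` on the solved face reached, hence at the start. [this work] -/
theorem solvedFaceDescentOn_iff (q : κ → unitInterval) :
    SolvedFaceDescentOn q ↔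
      ∀ G H : Fin 3 → Set (Set κ), (∀ i, IsUpperSet (G i)) → (∀ i, IsUpperSet (H i)) → (∀ i, H i ⊆ G i) →
        0 ≤ topForm q G H := by
  constructor
  · intro hD G H hG hH hHG
    obtain ⟨G', H', hG'up, hH'up, hH'G', -, -, hface, hle⟩ :=
      hD Finset.univ G H hG hH hHG (fun i => determinedBy_univ _) (fun i => determinedBy_univ _)
    have hmixed : MixedE3Nonneg q G' H' := by
      intro W hW
      have hup : ∀ i, IsUpperSet (W i) := by
        intro i; obtain ⟨j, hj | hj⟩ := hW i <;> rw [hj]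
        · exact hG'up j
        · exact hH'up j
      exact sahiE3_nonneg_of_solvedFaceDescentOn q hD (hup 0) (hup 1) (hup 2)
    exact le_trans (topForm_nonneg_of_inSolvedFace q G' H' hG'up hH'up hH'G' hmixed hface) hle
  · intro hlaw S G H hG hH hHG _ _
    refine ⟨fun _ => ∅, fun _ => ∅, fun _ => isUpperSet_empty, fun _ => isUpperSet_empty, fun _ => le_rfl,
      fun _ => determinedBy_empty _, fun _ => determinedBy_empty _, ?_, ?_⟩
    · exact inSolvedFace_of_bottom₀_empty q _ _ rfl
    · rw [topForm_empty]
      exact hlaw G H hG hH hHG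

/-- **`SolvedFaceDescent ↔ SahiTwoLevelPlus`**: the typed target of the variational route is a restatement of the two-level top law. [this work] -/
theorem solvedFaceDescent_iff_sahiTwoLevelPlus : SolvedFaceDescent ↔ SahiTwoLevelPlus := by
  constructor
  · intro h κ _ q G H hG hH hHG
    have := (solvedFaceDescentOn_iff q).1 (h κ q) G H hG hH hHG
    rwa [topForm_def] at this
  · intro h κ _ q
    exact (solvedFaceDescentOn_iff q).2 fun G H hG hH hHG => by
      rw [topForm_def]; exact h κ q G H hG hH hHG

/-- The variational route's Kahn reduction factors through the known one: under the equivalence it IS `kahnConjecture_of_sahiTwoLevelPlus`.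
[this work] -/
theorem kahnConjecture_of_solvedFaceDescent' (h : SolvedFaceDescent) : KahnConjecture :=
  kahnConjecture_of_sahiTwoLevelPlus (solvedFaceDescent_iff_sahiTwoLevelPlus.1 h)

end SahiTwoLevelVariational

end Summit.CriticalPhenomena.PercolationContinuityZ3.Theorems
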